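import Summits.BirchSwinnertonDyer.Rank1Residual.O5.T36KummerAlternation
import HarnessLib

/-!
# O5b / T36 — Kobayashi's formal group under tame Kummer descent, II: the TARGET T36 over the interface `CycLine`, the assembly SHAPE,
# and level 5 on the α pair (K8-2 MISS; law P′, T36-BD4)
(cell `b2b-bsdres`, lane CLASS-CLOSURE §3.5 O5, team o5; planner o5-r1 GEN 19 — memo `HOME/b2b-bsdres-o5-r1/gen19/T36-KUMMER-DESCENT.md`;
 typer of record cc-typer-5 GEN 15, docket (c24); second of three siblings (o5-r1's sections (3) `Target` and (3b) `Level5Alpha`);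
 namespace `Summit.BirchSwinnertonDyer.Rank1Residual.O5.T36`; 0 Literature facts.)

HONEST FRAMING (cell `b2b-bsdres`, run/shared/lean/b2b/bsd-rank1-residual/, verbatim in every file): the goal of the cell is
to DELETE the COMBINATION-SHAPED residual classes of the Birch–Swinnerton-Dyer formula for ALL analytic-rank `≤ 1` elliptic
curves over `ℚ` — "full BSD formula for every rank `≤ 1` curve in class `C`" assembled STRICTLY from published theorems — so that
the rank-`≤ 1` remainder becomes exactly the CONSTRUCTION-SHAPED classes, which are TYPED (missing-input `Prop`s), NOT attempted.
This is not "finishing BSD". Lane CLASS-CLOSURE / team o5: research routes; census output is EVIDENCE / conjecture items, never a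
Literature fact; no main conjecture inside any certificate; nothing is booked; no mark of `RESIDUAL-MAP.md` moves; O5 stays OPEN.

WHAT THIS FILE TYPES (o5-r1's words).
(3) `Target`: the GEN-19 target T36 as `Prop`-valued definitions over an explicit interface `CycLine` (defect sequences per curve and line,
    class bits) — `T36_BD` (bounded defect, `d ≤ 2`), its `S`-form and `Gb`-form and `P`-form, and the assembly SHAPE `BD → CTRL → IMC± →
    GZK → BSD₃` (`T36Chain.Assembly`) with the downstream clauses as interface `Prop`s (they have no definition in the tree: asks D-T33-1 /
    A-O5-3x stand).  Nothing is asserted.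
(3b) `Level5Alpha`: level 5 on the α pair (kit j156361, record 2205d1) — the K8-2 MISS and its consequences, MEASURED NUMBERS ONLY as
    data: an interface realising the measured III-α value at level 5 violates `T36_BD` as typed (`T36_BD_refuted_by_alpha5`), the
    α-clause of `T36_P`, and the bound `d ≤ 2` on the III*-α line; hence the weakened standing targets `T36_BD4` (d = 4) and law P′
    (`T36_P5`: onset 4 on III-β, 5 elsewhere; size `3^4` on III*-α, `3^2` elsewhere) with its level-6 FORECASTS (`T36_P5_level6`;
    PREREG-K13 / K13b — decided at LEVEL 6, o5-r1 GEN 20+); PREREG-K11 K11-1 / V11-c HITs recorded (`k11_1_hit`, `v11c_hit`).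

TYPING DISCIPLINE (cc-lead GEN 59 (c24), OWNERS l.758 (α)–(ε); o5-r1 GEN 19 A-O5-42, requests l.2867, `b2b-bsdres-o5-r1/gen19/HANDOFF.md`
l.56; census-lead G-33 'yours to route'): (α) measured records are `def` DATA with EVIDENCE docstrings (engine KDELTA `signed_job5.py`
a050b8c5df153fd9; kit j156361 / j158099 / j158102 / j158187 / j159305 / j159507 / j159568 / j159741 / j159795; census-lead G-33: K11a
one-implementation EVIDENCE REPRODUCED from raw, K11-1 / V11-c HIT as registered, sheet reading U on the 3 β rows; O5 OPEN; not a
Literature fact); (β) laws are `def … : Prop` over ABSTRACT profiles `ℕ → ℕ` / the interface `CycLine`, and the lemmas are pure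
`decide` / `omega` arithmetic; (γ) NO declaration asserts a law for a curve — the dead laws S / G-b / G-u / 'α never' / T36-BD(d ≤ 2)
appear only through their incompatibility / refutation lemmas, the standing targets (law P′ `T36_P5`, `T36_BD4`, C-T36-3‴, C-T36-4′)
only as `Prop`-valued definitions labelled with o5-r1's PREREG ids and 'decided at LEVEL 6, GEN 20+' (no `@[conjecture]` node is
minted: the conjecture "the census curves realise law P′" has no curve-level decl here by (γ), so there is no closed `Prop` to tag);
(δ) `T36Chain.Assembly` is an abstract schema with displayed binders, imported into NO CLASS END; (ε) 0 facts, zero kit by the typer,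
one proposal in flight.  The typer's only edits to o5-r1's bytes (source `b2b-bsdres-o5-r1/gen19/T36KummerDescent.lean` sha16
`8a38a4e385d5af39`, 564 l., `lean check` rc 0 on the farm as is): the split into three sibling files (`lint.size`), the module
docstrings, and ONE-LINE docstrings on the declarations that had none (`lint.docstring`); every declaration body is byte-identical.
NOT the typer's (cc-lead GEN 59): A-O5-41 (o5-r1 GEN 20's scoring) and A-O5-43 (explicit f / distance law / N-T36-3 SD₁₆ / Q₈ group lemma).

DEDUP (`lean search`): `CycLine`, `T36_BD`, `T36_P5`, `T36Chain` — no match.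
References: as in `O5/T36KummerAlternation.lean`.
-/

set_option autoImplicit false

namespace Summit.BirchSwinnertonDyer.Rank1Residual.O5.T36

/-! ## (3) The target T36 over an explicit interface (nothing asserted) -/
section Target

/-- Interface: what the census measures per O5b-irr curve `E` (a label) on the cyclotomic line.
`kA E n` = `κ_Δ(A_E(n))` (own line), `isBeta`, `isIIIstar` the class bits (law L4: β iff `ā·b̄ ≠ −1`). -/
structure CycLine (Label : Type) where
  kA : Label → ℕ → ℕ
  isBeta : Label → Bool
  isIIIstar : Label → Bool

variable {Label : Type}

/-- T36-BD: bounded defect `≤ 3^2` on every cyclotomic line, zero off class β and below level 4. -/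
def T36_BD (X : CycLine Label) : Prop :=
  ∀ E n, X.kA E n ≤ 2 ∧ (X.isBeta E = false → X.kA E n = 0) ∧ (n ≤ 3 → X.kA E n = 0)

/-- S-form: III-β curves carry the `(ℤ/3)²` at even `n ≥ 4`, III*-β curves at odd `n ≥ 5`, nothing else. -/
def T36_S (X : CycLine Label) : Prop :=
  ∀ E n, X.kA E n = (if X.isBeta E && decide (4 ≤ n) && (decide (n % 2 = 0) == !X.isIIIstar E) then 2 else 0)

/-- Gb-form: III-β curves carry it at all `n ≥ 4`, III*-β never. -/
def T36_Gb (X : CycLine Label) : Prop :=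
  ∀ E n, X.kA E n = (if X.isBeta E && !X.isIIIstar E && decide (4 ≤ n) then 2 else 0)

/-- P-form (selected by level 5): a β curve carries the `(ℤ/3)²` from its ONSET level on — 4 for Kodaira III, 5 for III* — and nothing else does. [conj] -/
def onset (X : CycLine Label) (E : Label) : ℕ := if X.isIIIstar E then 5 else 4

/-- P-form of the target: a β curve carries the `(ℤ/3)²` from its onset level on, nothing else does. A `Prop` on the interface `CycLine`; nothing asserted (standing target, decided at LEVEL 6, o5-r1 GEN 20+). [conj] -/
def T36_P (X : CycLine Label) : Prop :=
  ∀ E n, X.kA E n = (if X.isBeta E && decide (onset X E ≤ n) then 2 else 0)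

/-- The P-form implies the bounded-defect form T36-BD. Pure arithmetic over the interface. [folklore] -/
theorem T36_P_implies_BD (X : CycLine Label) (h : T36_P X) : T36_BD X := by
  intro E n
  have := h E n
  refine ⟨?_, ?_, ?_⟩
  · rw [this]; split <;> omega
  · intro hb; rw [this]; simp [hb]
  · intro hn; rw [this]
    have : decide (onset X E ≤ n) = false := by
      simp only [onset, decide_eq_false_iff_not, not_le]; split <;> omega
    simp [this]

/-- The S-form implies T36-BD. Pure arithmetic over the interface. [folklore] -/
theorem T36_S_implies_BD (X : CycLine Label) (h : T36_S X) : T36_BD X := by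
  intro E n
  have := h E n
  refine ⟨?_, ?_, ?_⟩
  · rw [this]; split <;> omega
  · intro hb; rw [this]; simp [hb]
  · intro hn; rw [this]
    have : decide (4 ≤ n) = false := by simp; omega
    simp [this]

/-- The Gb-form implies T36-BD. Pure arithmetic over the interface. [folklore] -/
theorem T36_Gb_implies_BD (X : CycLine Label) (h : T36_Gb X) : T36_BD X := by
  intro E n
  have := h E n
  refine ⟨?_, ?_, ?_⟩
  · rw [this]; split <;> omega
  · intro hb; rw [this]; simp [hb]
  · intro hn; rw [this]
    have : decide (4 ≤ n) = false := by simp; omega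
    simp [this]

/-- The downstream clauses have no definition in the tree (asks D-T33-1, A-O5-31..40 stand): they enter as interface `Prop`s. -/
structure T36Chain where
  BD : Prop      -- T36-BD (above, for the measured interface)
  CTRL : Prop    -- signed control with finite error `3^{≤ d}` from `D_E(n) = A/(A⁺+A⁻)`
  IMC : Prop     -- signed main conjecture for potentially supersingular `E`, tame `e = 4` (not in print for additive reduction)
  GZK : Prop     -- rank ≤ 1 input (Gross–Zagier–Kolyvagin / non-vanishing of the signed `L`-value)
  BSD3 : Prop    -- 3-part of BSD for the O5b-irr curves of analytic rank ≤ 1, up to `3^{≤ d}`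

/-- the ASSEMBLY SHAPE of the GEN-19 target (a definition, not a theorem): -/
def T36Chain.Assembly (P : T36Chain) : Prop := P.BD → P.CTRL → P.IMC → P.GZK → P.BSD3

end Target

/-! ## (3b) Level 5 on the α pair (kit j156361, record 2205d1, 10:04Z) — K8-2 MISS and its consequences (measured numbers only) -/
section Level5Alpha

variable {Label : Type}

/-- measured record of the III-α row 2205d1 at `n = 5`: `(κ_Δ(A), κ_s(B), κ_Δ(B), κ_s(A)) = (2, 6, 4, 3)` (level 4: `(0, 2, 0, 0)`). -/
def k8_2205d1_n5 : ℕ × ℕ × ℕ × ℕ := (2, 6, 4, 3)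

/-- PREREG-K11 (28d4936a), kit j158099 [meas; log t36/j158099_stdout.log]: the CM III-β row
`h-x3m3x` at level 5, record `(κ_Δ(A), κ_s(B) ‖ κ_Δ(B), κ_s(A)) = (2,4 ‖ 2,3)`, `κ = 6`, `κ_w = 5`, ranks `(122,365,1)` valid,
largest elementary divisor `3³` — identical to the non-CM β row `3150f1` in every printed invariant. -/
def k11_hx3m3x_n5 : ℕ × ℕ × ℕ × ℕ := (2, 4, 2, 3)

/-- K11-1 HIT (credence .7 registered): the CM row carries the class-β0 level-5 record; so the curve-free lattice `f(U_5)`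
(section `HondaTwist`) has the measured III-β / III*-β defects `(2, 2)` at level 5. -/
theorem k11_1_hit : k11_hx3m3x_n5 = k8_3150f1_n5 := by decide

/-- law P′ replicated on the CM row at level 5: `(κ_Δ(A,5), κ_Δ(B,5)) = (2,2)`. -/
theorem k11_cm_level5_is_P' : (k11_hx3m3x_n5.1, k11_hx3m3x_n5.2.2.1) = (2, 2) := by decide

/-- kit j158099 DONE (log t36/j158099_stdout.log 579bef58, outputs t36/j158099_signed.jsonl 989e81c0, score t36/k11_score_K11a.txt
3be7f47e): the second CM model `h-x3p3x` (y² = x³ + 3x) at level 5 prints the identical record — PREREG-K11 V11-c HIT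
(engine invariance under the choice of CM model; theorem-level expectation .97). -/
def k11_hx3p3x_n5 : ℕ × ℕ × ℕ × ℕ := (2, 4, 2, 3)

/-- PREREG-K11 V11-c HIT: the two CM models print the identical level-5 record. By `decide` on the recorded numbers. [meas: kit j158099] -/
theorem v11c_hit : k11_hx3p3x_n5 = k11_hx3m3x_n5 := by decide

/-- LEVEL-5 TABLE of cyclotomic-line defects `κ_Δ` by line = (isIIIstar, isBeta):
III-β 2 (level 4: 2), III*-β 2 (0), III-α 2 (0), III*-α 4 (0); controls: good `a₃ = 0` 0, `a₃ = −3` 8 (2). -/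
def defect4 (isIIIstar isBeta : Bool) : ℕ := if isBeta && !isIIIstar then 2 else 0
/-- LEVEL-5 table of cyclotomic-line defects by line `(isIIIstar, isBeta)`: III*-α `4`, the three other lines `2` (see `defect4` for level 4). Measured numbers as data. [meas: kit j156361 / j158099] -/
def defect5 (isIIIstar isBeta : Bool) : ℕ := if isIIIstar && !isBeta then 4 else 2

/-- Every line carries a defect at level 5 (table `defect5`). By `decide` on the recorded numbers. [meas] -/
theorem defect5_pos : ∀ s b, 0 < defect5 s b := by decide
/-- No line's defect decreases from level 4 to level 5 (tables). By `decide`. [meas] -/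
theorem defect5_ge_defect4 : ∀ s b, defect4 s b ≤ defect5 s b := by decide
/-- the only line measured at two levels with a defect present (III-β) did NOT grow: -/
theorem IIIbeta_no_growth : defect4 false true = defect5 false true := by decide

/-- K8-2: an interface realising the measured III-α value at level 5 violates `T36_BD` as typed (zero off β) … -/
theorem T36_BD_refuted_by_alpha5 (X : CycLine Label) (E : Label)
    (hα : X.isBeta E = false) (h5 : X.kA E 5 = 2) : ¬ T36_BD X := by
  intro h; have := (h E 5).2.1 hα; omega

/-- … and the α-clause of `T36_P` ('nothing else does'): -/
theorem T36_P_alpha_clause_refuted (X : CycLine Label) (E : Label)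
    (hα : X.isBeta E = false) (h5 : X.kA E 5 = 2) : ¬ T36_P X := by
  intro h; have := h E 5; simp [hα] at this; omega

/-- … and the bound `d ≤ 2` is violated on the III*-α line: -/
theorem T36_BD_refuted_by_IIIstar_alpha5 (X : CycLine Label) (E : Label) (h5 : X.kA E 5 = 4) : ¬ T36_BD X := by
  intro h; have := (h E 5).1; omega

/-- T36-BD4: the weakest bounded-defect clause still consistent with every measurement through level 5
(`d = 4`; exact through level 3 by LMI(≤3)). [conj; decided at level 6 by PREREG-K13 / K13b] -/
def T36_BD4 (X : CycLine Label) : Prop := ∀ E n, X.kA E n ≤ 4 ∧ (n ≤ 3 → X.kA E n = 0)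

/-- law P′ (post hoc at level 5): onset 4 on the III-β line, 5 on the three other lines; size `3^4` on III*-α, `3^2` elsewhere; persistent. [conj] -/
def onset' (X : CycLine Label) (E : Label) : ℕ := if X.isBeta E && !X.isIIIstar E then 4 else 5
/-- law P′ size: `3^4` on III*-α, `3^2` elsewhere (= `defect5`). Bookkeeping. [conj] -/
def size' (X : CycLine Label) (E : Label) : ℕ := defect5 (X.isIIIstar E) (X.isBeta E)

/-- law P′ as a `Prop` on the interface: `κ_Δ(A_E, n) = size′(E)` from `onset′(E)` on, `0` before (post hoc at level 5; standing target, decided at LEVEL 6 by PREREG-K13 / K13b, o5-r1 GEN 20+). Nothing asserted for a curve. [conj] -/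
def T36_P5 (X : CycLine Label) : Prop :=
  ∀ E n, X.kA E n = (if onset' X E ≤ n then size' X E else 0)

/-- Law P′ implies the weakened bounded-defect clause T36-BD4. Pure arithmetic over the interface. [folklore] -/
theorem T36_P5_implies_BD4 (X : CycLine Label) (h : T36_P5 X) : T36_BD4 X := by
  intro E n
  have := h E n
  refine ⟨?_, ?_⟩
  · rw [this]; unfold size' defect5; split <;> (try split) <;> omega
  · intro hn; rw [this]
    have : ¬ onset' X E ≤ n := by unfold onset'; split <;> omega
    simp [this]

/-- P′ restricted to β curves is P: -/
theorem T36_P5_on_beta (X : CycLine Label) (h : T36_P5 X) (E : Label) (hb : X.isBeta E = true) (n : ℕ) :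
    X.kA E n = (if onset X E ≤ n then 2 else 0) := by
  have := h E n; rw [this]; unfold onset' size' onset defect5; simp [hb]; cases X.isIIIstar E <;> simp

/-- level-6 forecasts under P′ (PREREG-K13: β CM row (2,2); PREREG-K13b: α row (2,4)); growth anywhere kills `T36_BD4`. -/
theorem T36_P5_level6 (X : CycLine Label) (h : T36_P5 X) (E : Label) : X.kA E 6 = size' X E := by
  have := h E 6; rw [this]; unfold onset'; split <;> simp

end Level5Alpha

end Summit.BirchSwinnertonDyer.Rank1Residual.O5.T36
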